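import Mathlib
import Summits.CriticalPhenomena.CardyFormulaZ2.Theorems.CardySelfRefinementDefs
import Summits.CriticalPhenomena.CardyFormulaZ2.Theorems.CardySelfRefinementRussoDriftPolynomial
import Literature.Probability.Percolation.PivotalCell
import HarnessLib

/-!
# Dyadic summation for stub `stub_sixArmSectorMass` (line `far-field-is-a-quarter-turn`, crux
`TrivialSectorRate`, stmt-CriticalPhenomena-10266): the six-arm sector mass from three inputs

`sixArmSectorMass_of_boundaryRelevance` (registered helper): for a fixed `k > 0`, path `γ` and quad
family `F`, the conclusion of `stub_sixArmSectorMass` — for every `R₀ ≥ 1`,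
`Σ_{u ∈ U, R₀ ≤ farScale u} Six(u, ⌊farScale u⌋) ≤ C η^ε'` uniformly in `s`, small `η` and finite
`U` — follows from

* (H6) `SixArmDecayAlong k γ`: six alternating arms `≤ C₆ (r/R)^{2+ε}` (the hypothesis of the stub);
* (HB) **boundary relevance above one** for `F` along `γ` — VERBATIM the hypothesis (HB) of
  `weightedPivotalMass_of_factorisation` (stub `stub_pivotalMass`): for every lattice scale `D ≥ 1`,
  summed over the blocks within plane distance `2Dη` of the quad boundaries,
  `M_k(γ s)(Rel u D) ≤ C₀ D² min(1, (Dη)^b)` with `b > 0`;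
* (HF) **far-field factorisation** of the sector term: for `k + 1 ≤ R'`, `R' + k ≤ R`,
  `Six(u, R) ≤ M_k(γ s)(sixArmThreeClustersAt (k•u) (k+1) R') · M_k(γ s)(Rel u R)` — PROVED in
  `…StubSixArmSectorMassFactorisation` (`Six_le_real_sixArm_mul_real_Rel`, independence of the
  inside of the `R'`-box and the outside of the `R`-box under the product coin measure).

Proof.  A far block `u` (`x_u = farScale u ≥ R₀ ≥ 1`, `R_u = ⌊x_u⌋`, `bdist u = 8ηx_u`) with
`x_u < B := max R₀ (4k)` has `Six ≤ M(Rel u R_u) ≤ M(Rel u (4B))` and `bdist u < 2·(4B)·η`, so these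
blocks are charged to (HB) at scale `4B`: `≤ C₀ (4B)² (4Bη)^{b'}`.  The blocks with
`X = 2^jB ≤ x_u < 2X` have, by (HF) at `R' = R_u − k` and (H6),
`Six ≤ C₆ ((k+1)/(R_u−k))^{2+ε} M(Rel u R_u) ≤ C₆ (2(k+1)/X)^{2+ε} M(Rel u (8X))`, and
`bdist u < 2·(8X)·η`, so (HB) at scale `8X` bounds the layer by
`K X^{−(2+ε)} X² (Xη)^{b'} = K X^{b'−ε} η^{b'} ≤ K 2^{−jε/2} η^{b'}` (`b' = min(b, ε/2)`), a geometric
series.  Hence `ε' = b'`, `η₁ = η₀`.  No quad regularity and no arm exponent beyond the inputs is used.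
-/

noncomputable section

namespace Summit.CriticalPhenomena.CardyFormulaZ2.Theorems.CardySelfRefinement.FarField

open scoped Topology
open Filter Set MeasureTheory
open Literature.Probability.LatticeModels Literature.Probability.Percolation
open Literature.Probability.Percolation.QuadCrossing
open Summit.CriticalPhenomena.CardyFormulaZ2.Theses.CardySelfRefinement

/-! ## Real-variable lemmas -/

/-- `min 1 (x^b) ≤ x^{b'}` for `0 ≤ b' ≤ b`, `x > 0` (local copy of `min_one_rpow_le_rpow` of the
pivotal-mass weights file). -/
private theorem min_one_rpow_le_rpow_of_le {x b b' : ℝ} (hx : 0 < x) (hb' : 0 ≤ b') (hb'b : b' ≤ b) :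
    min 1 (x ^ b) ≤ x ^ b' := by
  rcases le_or_gt x 1 with h | h
  · exact (min_le_right _ _).trans (Real.rpow_le_rpow_of_exponent_ge hx h hb'b)
  · exact (min_le_left _ _).trans (Real.one_le_rpow h.le hb')

/-- The geometric factor of the dyadic layers: `(2^j B)^{−ε/2} ≤ (2^{−ε/2})^j` for `B ≥ 1` (local copy
of `rpow_neg_le_geom` of the pivotal-mass weights file). -/
private theorem rpow_neg_half_le_geom {ε : ℝ} (hε : 0 < ε) {B : ℕ} (hB : 1 ≤ B) (j : ℕ) :
    ((2 ^ j * B : ℕ) : ℝ) ^ (-(ε / 2)) ≤ ((2 : ℝ) ^ (-(ε / 2))) ^ j := by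
  have h2j : (0 : ℝ) < (2 : ℝ) ^ j := by positivity
  have hB' : (1 : ℝ) ≤ B := by exact_mod_cast hB
  have hle : (2 : ℝ) ^ j ≤ ((2 ^ j * B : ℕ) : ℝ) := by
    push_cast
    nlinarith
  calc ((2 ^ j * B : ℕ) : ℝ) ^ (-(ε / 2))
      ≤ ((2 : ℝ) ^ j) ^ (-(ε / 2)) := Real.rpow_le_rpow_of_nonpos h2j hle (by linarith)
    _ = ((2 : ℝ) ^ (-(ε / 2))) ^ j := by
        rw [← Real.rpow_natCast, ← Real.rpow_mul (by norm_num : (0:ℝ) ≤ 2), mul_comm,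
          Real.rpow_mul (by norm_num : (0:ℝ) ≤ 2), Real.rpow_natCast]

/-- The layer algebra: `A (a/X)^{2+ε} · (C (8X)² (8Xη)^{b'}) ≤ (64·8^{b'} A C a^{2+ε}) X^{−ε/2} η^{b'}`
for `X ≥ 1`, `b' − ε ≤ −ε/2`. -/
theorem sector_layer_algebra {ε b' a A C X η : ℝ} (hX : 1 ≤ X) (hη : 0 < η) (ha : 0 ≤ a)
    (hA : 0 ≤ A) (hC : 0 ≤ C) (hb'ε : b' - ε ≤ -(ε / 2)) :
    A * (a / X) ^ (2 + ε) * (C * (8 * X) ^ 2 * (8 * X * η) ^ b') ≤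
      (64 * (8 : ℝ) ^ b' * A * C * a ^ (2 + ε)) * X ^ (-(ε / 2)) * η ^ b' := by
  have hX0 : 0 < X := by linarith
  have h1 : (a / X) ^ (2 + ε) = a ^ (2 + ε) * X ^ (-(2 + ε)) := by
    rw [Real.div_rpow ha hX0.le, Real.rpow_neg hX0.le, div_eq_mul_inv]
  have h2 : (8 * X * η) ^ b' = 8 ^ b' * X ^ b' * η ^ b' := by
    rw [Real.mul_rpow (by positivity) hη.le, Real.mul_rpow (by norm_num) hX0.le]
  have h3 : X ^ (-(2 + ε)) * X ^ (2 : ℕ) * X ^ b' = X ^ (b' - ε) := by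
    rw [← Real.rpow_natCast X 2, ← Real.rpow_add hX0, ← Real.rpow_add hX0]
    congr 1
    push_cast
    ring
  have h4 : X ^ (b' - ε) ≤ X ^ (-(ε / 2)) := Real.rpow_le_rpow_of_exponent_le hX hb'ε
  have hK : 0 ≤ 64 * (8 : ℝ) ^ b' * A * C * a ^ (2 + ε) := by positivity
  calc A * (a / X) ^ (2 + ε) * (C * (8 * X) ^ 2 * (8 * X * η) ^ b')
      = (64 * (8 : ℝ) ^ b' * A * C * a ^ (2 + ε)) * (X ^ (-(2 + ε)) * X ^ (2 : ℕ) * X ^ b') * η ^ b' := by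
        rw [h1, h2]; ring
    _ = (64 * (8 : ℝ) ^ b' * A * C * a ^ (2 + ε)) * X ^ (b' - ε) * η ^ b' := by rw [h3]
    _ ≤ (64 * (8 : ℝ) ^ b' * A * C * a ^ (2 + ε)) * X ^ (-(ε / 2)) * η ^ b' :=
        mul_le_mul_of_nonneg_right (mul_le_mul_of_nonneg_left h4 hK) (by positivity)

/-- `Rel` is monotone in the radius (local copy of `Rel_mono` of the pivotal-mass dictionary). -/
private theorem Rel_mono_aux (k m : ℕ) (F : Fin m → Quad (univ : Set ℂ)) (η : ℝ) (u : Site 2)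
    {R R' : ℕ} (h : R ≤ R') : Rel k m F η u R ⊆ Rel k m F η u R' := fun _ hω =>
  IsPivotalOn.mono hω fun _ he => ⟨he.1, fun v hv => box_mono 2 h (he.2 v hv)⟩

/-! ## The summation theorem -/

/-- **SIX-ARM SECTOR MASS FROM (H6) + (HB) + (HF)** (registered helper of `stub_sixArmSectorMass`;
see the module docstring).  The hypotheses: six-arm decay along `γ`; boundary relevance above one for
`F` along `γ` (verbatim the (HB) of `weightedPivotalMass_of_factorisation`); far-field factorisation
of the sector term (proved: `Six_le_real_sixArm_mul_real_Rel`). -/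
theorem sixArmSectorMass_of_boundaryRelevance {k : ℕ} (hk : 0 < k) {γ : unitInterval → ℝ × ℝ}
    (h6 : SixArmDecayAlong k γ) {m : ℕ} {F : Fin m → Quad (univ : Set ℂ)}
    (hB : ∃ b C₀ η₀ : ℝ, 0 < b ∧ 0 < η₀ ∧ ∀ (s : unitInterval), ∀ η ∈ Set.Ioo (0 : ℝ) η₀, ∀ (D : ℕ), 1 ≤ D →
        ∀ U : Finset (Site 2),
          ∑ u ∈ U.filter (fun u => bdist k m F η u < 2 * D * η),
            (M k (γ s).1 (γ s).2).real (Rel k m F η u D) ≤ C₀ * (D : ℝ) ^ 2 * min 1 (((D : ℝ) * η) ^ b))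
    (hF : ∀ (s : unitInterval) (η : ℝ), 0 < η → ∀ (u : Site 2) (R' R : ℕ), k + 1 ≤ R' → R' + k ≤ R →
        Six k m F η (γ s) u R ≤
          (M k (γ s).1 (γ s).2).real (sixArmThreeClustersAt (ctr k u) (k + 1) R') *
            (M k (γ s).1 (γ s).2).real (Rel k m F η u R))
    (R₀ : ℕ) (hR₀ : 1 ≤ R₀) :
    ∃ ε C η₁ : ℝ, 0 < ε ∧ 0 ≤ C ∧ 0 < η₁ ∧ ∀ (s : unitInterval), ∀ η ∈ Set.Ioo (0 : ℝ) η₁,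
      ∀ U : Finset (Site 2),
        ∑ u ∈ U.filter (fun u => (R₀ : ℝ) ≤ farScale k m F η u),
          Six k m F η (γ s) u ⌊farScale k m F η u⌋₊ ≤ C * η ^ ε := by
  obtain ⟨ε, C₆, hε, h6⟩ := h6
  obtain ⟨b, C₀, η₀, hb, hη₀, hB⟩ := hB
  -- nonnegative majorants of the constants
  obtain ⟨C₆', hC₆'⟩ : ∃ C : ℝ, C = max C₆ 0 := ⟨_, rfl⟩
  obtain ⟨C₀', hC₀'⟩ : ∃ C : ℝ, C = max C₀ 0 := ⟨_, rfl⟩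
  have hC₆'0 : 0 ≤ C₆' := hC₆' ▸ le_max_right _ _
  have hC₀'0 : 0 ≤ C₀' := hC₀' ▸ le_max_right _ _
  have hC₆le : C₆ ≤ C₆' := hC₆' ▸ le_max_left _ _
  have hC₀le : C₀ ≤ C₀' := hC₀' ▸ le_max_left _ _
  -- the base scale `B ≥ R₀, 4k`
  obtain ⟨B, hBdef⟩ : ∃ R : ℕ, R = max R₀ (4 * k) := ⟨_, rfl⟩
  have hR₀B : R₀ ≤ B := hBdef ▸ le_max_left _ _
  have hkB : 4 * k ≤ B := hBdef ▸ le_max_right _ _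
  have hB1 : 1 ≤ B := hR₀.trans hR₀B
  have hB1r : (1 : ℝ) ≤ B := by exact_mod_cast hB1
  have hBpos : (0 : ℝ) < B := by linarith
  -- exponents and the geometric ratio
  obtain ⟨b', hb'def⟩ : ∃ x : ℝ, x = min b (ε / 2) := ⟨_, rfl⟩
  have hb'0 : 0 < b' := hb'def ▸ lt_min hb (by linarith)
  have hb'b : b' ≤ b := hb'def ▸ min_le_left _ _
  have hb'ε : b' - ε ≤ -(ε / 2) := by have := min_le_right b (ε / 2); rw [← hb'def] at this; linarith
  obtain ⟨q, hqdef⟩ : ∃ x : ℝ, x = (2 : ℝ) ^ (-(ε / 2)) := ⟨_, rfl⟩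
  have hq0 : 0 ≤ q := hqdef ▸ Real.rpow_nonneg (by norm_num) _
  have hq1 : q < 1 := hqdef ▸ Real.rpow_lt_one_of_one_lt_of_neg (by norm_num) (by linarith)
  have h1q : 0 < 1 - q := by linarith
  -- constants
  obtain ⟨a, hadef⟩ : ∃ x : ℝ, x = 2 * ((k : ℝ) + 1) := ⟨_, rfl⟩
  have ha0 : 0 ≤ a := by rw [hadef]; positivity
  obtain ⟨Ks, hKsdef⟩ : ∃ x : ℝ, x = C₀' * ((4 * B : ℕ) : ℝ) ^ 2 * ((4 * B : ℕ) : ℝ) ^ b' := ⟨_, rfl⟩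
  have hKs0 : 0 ≤ Ks := by rw [hKsdef]; positivity
  obtain ⟨K₁, hK₁def⟩ : ∃ x : ℝ, x = 64 * (8 : ℝ) ^ b' * C₆' * C₀' * a ^ (2 + ε) := ⟨_, rfl⟩
  have hK₁0 : 0 ≤ K₁ := by rw [hK₁def]; positivity
  refine ⟨b', Ks + K₁ * (1 - q)⁻¹, η₀, hb'0, by positivity, hη₀, ?_⟩
  intro s η hη U
  have hη0 : 0 < η := hη.1
  haveI := isProbabilityMeasure_M k (γ s).1 (γ s).2
  -- shorthands: far-field scale `x u` and the summand `f u`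
  obtain ⟨x, hxdef⟩ : ∃ g : Site 2 → ℝ, g = farScale k m F η := ⟨_, rfl⟩
  obtain ⟨f, hfdef⟩ : ∃ g : Site 2 → ℝ, g = fun u => Six k m F η (γ s) u ⌊x u⌋₊ := ⟨_, rfl⟩
  have hf0 : ∀ u, 0 ≤ f u := fun u => by rw [hfdef]; exact measureReal_nonneg
  have hbd0 : ∀ u, 0 ≤ bdist k m F η u := fun u => by unfold bdist; exact Metric.infDist_nonneg
  have hx0 : ∀ u, 0 ≤ x u := fun u => by
    rw [hxdef]; unfold farScale; exact div_nonneg (hbd0 u) (by positivity)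
  have hbd_eq : ∀ u, bdist k m F η u = 8 * η * x u := fun u => by
    rw [hxdef]; unfold farScale; field_simp
  -- (HB) at scale `D` over blocks within `2Dη`, with the majorant constant and the exponent `b'`
  have hBD : ∀ (D : ℕ), 1 ≤ D → ∀ (W : Finset (Site 2)),
      (∀ u ∈ W, bdist k m F η u < 2 * D * η) →
      ∑ u ∈ W, (M k (γ s).1 (γ s).2).real (Rel k m F η u D) ≤ C₀' * (D : ℝ) ^ 2 * ((D : ℝ) * η) ^ b' := by
    intro D hD W hW
    have hD0 : (0 : ℝ) < D := by exact_mod_cast hD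
    have hfil : W.filter (fun u => bdist k m F η u < 2 * D * η) = W := Finset.filter_true_of_mem hW
    have h := hB s η hη D hD W
    rw [hfil] at h
    have hmin0 : 0 ≤ min 1 (((D : ℝ) * η) ^ b) :=
      le_min zero_le_one (Real.rpow_nonneg (by positivity) _)
    have hmin : min 1 (((D : ℝ) * η) ^ b) ≤ ((D : ℝ) * η) ^ b' :=
      min_one_rpow_le_rpow_of_le (by positivity) hb'0.le hb'b
    calc ∑ u ∈ W, (M k (γ s).1 (γ s).2).real (Rel k m F η u D)
        ≤ C₀ * (D : ℝ) ^ 2 * min 1 (((D : ℝ) * η) ^ b) := h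
      _ ≤ C₀' * (D : ℝ) ^ 2 * min 1 (((D : ℝ) * η) ^ b) :=
          mul_le_mul_of_nonneg_right (mul_le_mul_of_nonneg_right hC₀le (by positivity)) hmin0
      _ ≤ C₀' * (D : ℝ) ^ 2 * ((D : ℝ) * η) ^ b' := mul_le_mul_of_nonneg_left hmin (by positivity)
  -- the bound holds over EVERY finite set of blocks (far-ness is not needed)
  suffices key : ∀ W : Finset (Site 2), ∑ u ∈ W, f u ≤ (Ks + K₁ * (1 - q)⁻¹) * η ^ b' by
    have h := key (U.filter (fun u => (R₀ : ℝ) ≤ farScale k m F η u))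
    rw [hfdef, hxdef] at h
    exact h
  intro W
  -- (1) the small blocks `x u < B`: `Six ≤ M(Rel u ⌊x u⌋) ≤ M(Rel u (4B))`, charged to (HB) at `4B`
  have hsmall : ∑ u ∈ W.filter (fun u => x u < B), f u ≤ Ks * η ^ b' := by
    have hD1 : 1 ≤ 4 * B := by omega
    have h1 : ∀ u ∈ W.filter (fun u => x u < B),
        f u ≤ (M k (γ s).1 (γ s).2).real (Rel k m F η u (4 * B)) := by
      intro u hu
      obtain ⟨-, hxB⟩ := Finset.mem_filter.1 hu
      have hRu : ⌊x u⌋₊ ≤ 4 * B := by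
        have : ⌊x u⌋₊ < B := (Nat.floor_lt (hx0 u)).2 hxB
        omega
      calc f u = Six k m F η (γ s) u ⌊x u⌋₊ := by rw [hfdef]
        _ ≤ (M k (γ s).1 (γ s).2).real (Rel k m F η u ⌊x u⌋₊) :=
            measureReal_mono Set.inter_subset_right (measure_ne_top _ _)
        _ ≤ (M k (γ s).1 (γ s).2).real (Rel k m F η u (4 * B)) :=
            measureReal_mono (Rel_mono_aux k m F η u hRu) (measure_ne_top _ _)
    have h2 : ∀ u ∈ W.filter (fun u => x u < B), bdist k m F η u < 2 * ((4 * B : ℕ) : ℝ) * η := by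
      intro u hu
      obtain ⟨-, hxB⟩ := Finset.mem_filter.1 hu
      have h8 : (0 : ℝ) < 8 * η := by positivity
      have := mul_lt_mul_of_pos_left hxB h8
      rw [hbd_eq u]
      push_cast
      linarith only [this]
    calc ∑ u ∈ W.filter (fun u => x u < B), f u
        ≤ ∑ u ∈ W.filter (fun u => x u < B), (M k (γ s).1 (γ s).2).real (Rel k m F η u (4 * B)) :=
          Finset.sum_le_sum h1
      _ ≤ C₀' * ((4 * B : ℕ) : ℝ) ^ 2 * (((4 * B : ℕ) : ℝ) * η) ^ b' := hBD (4 * B) hD1 _ h2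
      _ = Ks * η ^ b' := by
          rw [Real.mul_rpow (by positivity) hη0.le, hKsdef]
          ring
  -- (2) the dyadic layers `X = 2^j B ≤ x u < 2X`
  have hlayer : ∀ j : ℕ,
      ∑ u ∈ W.filter (fun u => ((2 ^ j * B : ℕ) : ℝ) ≤ x u ∧ x u < 2 * ((2 ^ j * B : ℕ) : ℝ)), f u ≤
        K₁ * q ^ j * η ^ b' := by
    intro j
    have hBX : B ≤ 2 ^ j * B := Nat.le_mul_of_pos_left _ (pow_pos two_pos j)
    have hX1n : 1 ≤ 2 ^ j * B := hB1.trans hBX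
    have hX1 : (1 : ℝ) ≤ ((2 ^ j * B : ℕ) : ℝ) := by exact_mod_cast hX1n
    have hX0 : (0 : ℝ) < ((2 ^ j * B : ℕ) : ℝ) := by linarith only [hX1]
    have hkX : 4 * k ≤ 2 ^ j * B := hkB.trans hBX
    -- per block: (HF) at `R' = R_u - k`, (H6), and `Rel u R_u ⊆ Rel u (8X)`
    have hblock : ∀ u ∈ W.filter (fun u => ((2 ^ j * B : ℕ) : ℝ) ≤ x u ∧ x u < 2 * ((2 ^ j * B : ℕ) : ℝ)),
        f u ≤ C₆' * (a / ((2 ^ j * B : ℕ) : ℝ)) ^ (2 + ε) *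
          (M k (γ s).1 (γ s).2).real (Rel k m F η u (8 * (2 ^ j * B))) := by
      intro u hu
      obtain ⟨-, hlo, hhi⟩ := Finset.mem_filter.1 hu
      obtain ⟨Ru, hRudef⟩ : ∃ R : ℕ, R = ⌊x u⌋₊ := ⟨_, rfl⟩
      have hXRu : 2 ^ j * B ≤ Ru := hRudef ▸ Nat.le_floor hlo
      have hRux : (Ru : ℝ) ≤ x u := hRudef ▸ Nat.floor_le (hx0 u)
      have hRu2X : (Ru : ℝ) < 2 * ((2 ^ j * B : ℕ) : ℝ) := lt_of_le_of_lt hRux hhi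
      have hkRu : 4 * k ≤ Ru := hkX.trans hXRu
      have hR'1 : k + 1 ≤ Ru - k := by omega
      have hR'2 : Ru - k + k ≤ Ru := by omega
      have hRu8X : Ru ≤ 8 * (2 ^ j * B) := by
        have h' : (Ru : ℝ) < ((2 * (2 ^ j * B) : ℕ) : ℝ) := by push_cast at hRu2X ⊢; exact hRu2X
        have h'' : Ru < 2 * (2 ^ j * B) := by exact_mod_cast h'
        omega
      -- (HF)
      have hFu := hF s η hη0 u (Ru - k) Ru hR'1 hR'2
      -- (H6) at `r = k + 1`, `R = Ru - k`
      have h6u := h6 s (ctr k u) (k + 1) (Ru - k) (by omega) hR'1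
      have hcast : ((Ru - k : ℕ) : ℝ) = (Ru : ℝ) - k := by
        rw [Nat.cast_sub (by omega)]
      have hden : ((2 ^ j * B : ℕ) : ℝ) / 2 ≤ (Ru : ℝ) - k := by
        have h1 : ((2 ^ j * B : ℕ) : ℝ) ≤ Ru := by exact_mod_cast hXRu
        have h2 : ((4 * k : ℕ) : ℝ) ≤ Ru := by exact_mod_cast hkRu
        push_cast at h2
        linarith only [h1, h2, hX0]
      have hratio : (((k + 1 : ℕ) : ℝ)) / ((Ru - k : ℕ) : ℝ) ≤ a / ((2 ^ j * B : ℕ) : ℝ) := by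
        rw [hcast, hadef]
        have hkk : (((k + 1 : ℕ) : ℝ)) = (k : ℝ) + 1 := by push_cast; ring
        rw [hkk]
        calc ((k : ℝ) + 1) / ((Ru : ℝ) - k)
            ≤ ((k : ℝ) + 1) / (((2 ^ j * B : ℕ) : ℝ) / 2) :=
              div_le_div_of_nonneg_left (by positivity) (by positivity) hden
          _ = 2 * ((k : ℝ) + 1) / ((2 ^ j * B : ℕ) : ℝ) := by
              field_simp
      have hratio0 : 0 ≤ (((k + 1 : ℕ) : ℝ)) / ((Ru - k : ℕ) : ℝ) := by positivity
      have hsix : (M k (γ s).1 (γ s).2).real (sixArmThreeClustersAt (ctr k u) (k + 1) (Ru - k)) ≤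
          C₆' * (a / ((2 ^ j * B : ℕ) : ℝ)) ^ (2 + ε) :=
        calc (M k (γ s).1 (γ s).2).real (sixArmThreeClustersAt (ctr k u) (k + 1) (Ru - k))
            ≤ C₆ * ((((k + 1 : ℕ) : ℝ)) / ((Ru - k : ℕ) : ℝ)) ^ (2 + ε) := h6u
          _ ≤ C₆' * ((((k + 1 : ℕ) : ℝ)) / ((Ru - k : ℕ) : ℝ)) ^ (2 + ε) :=
              mul_le_mul_of_nonneg_right hC₆le (Real.rpow_nonneg hratio0 _)
          _ ≤ C₆' * (a / ((2 ^ j * B : ℕ) : ℝ)) ^ (2 + ε) :=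
              mul_le_mul_of_nonneg_left
                (Real.rpow_le_rpow hratio0 hratio (by linarith only [hε])) hC₆'0
      have hRel : (M k (γ s).1 (γ s).2).real (Rel k m F η u Ru) ≤
          (M k (γ s).1 (γ s).2).real (Rel k m F η u (8 * (2 ^ j * B))) :=
        measureReal_mono (Rel_mono_aux k m F η u hRu8X) (measure_ne_top _ _)
      calc f u = Six k m F η (γ s) u Ru := by rw [hfdef, hRudef]
        _ ≤ (M k (γ s).1 (γ s).2).real (sixArmThreeClustersAt (ctr k u) (k + 1) (Ru - k)) *
              (M k (γ s).1 (γ s).2).real (Rel k m F η u Ru) := hFu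
        _ ≤ C₆' * (a / ((2 ^ j * B : ℕ) : ℝ)) ^ (2 + ε) *
              (M k (γ s).1 (γ s).2).real (Rel k m F η u (8 * (2 ^ j * B))) :=
            mul_le_mul hsix hRel measureReal_nonneg (by positivity)
    -- sum over the layer: (HB) at scale `8X`, the layer algebra and the geometric factor
    have hnear : ∀ u ∈ W.filter (fun u => ((2 ^ j * B : ℕ) : ℝ) ≤ x u ∧ x u < 2 * ((2 ^ j * B : ℕ) : ℝ)),
        bdist k m F η u < 2 * ((8 * (2 ^ j * B) : ℕ) : ℝ) * η := by
      intro u hu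
      obtain ⟨-, -, hhi⟩ := Finset.mem_filter.1 hu
      have h8 : (0 : ℝ) < 8 * η := by positivity
      have := mul_lt_mul_of_pos_left hhi h8
      rw [hbd_eq u]
      push_cast at this ⊢
      linarith only [this]
    have hD1 : 1 ≤ 8 * (2 ^ j * B) := by omega
    have hsum := hBD (8 * (2 ^ j * B)) hD1 _ hnear
    have hcast8 : ((8 * (2 ^ j * B) : ℕ) : ℝ) = 8 * ((2 ^ j * B : ℕ) : ℝ) := by push_cast; ring
    rw [hcast8] at hsum
    have hgeom : ((2 ^ j * B : ℕ) : ℝ) ^ (-(ε / 2)) ≤ q ^ j := by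
      rw [hqdef]
      exact rpow_neg_half_le_geom hε hB1 j
    have hpref : 0 ≤ C₆' * (a / ((2 ^ j * B : ℕ) : ℝ)) ^ (2 + ε) := by positivity
    calc ∑ u ∈ W.filter (fun u => ((2 ^ j * B : ℕ) : ℝ) ≤ x u ∧ x u < 2 * ((2 ^ j * B : ℕ) : ℝ)), f u
        ≤ ∑ u ∈ W.filter (fun u => ((2 ^ j * B : ℕ) : ℝ) ≤ x u ∧ x u < 2 * ((2 ^ j * B : ℕ) : ℝ)),
            C₆' * (a / ((2 ^ j * B : ℕ) : ℝ)) ^ (2 + ε) *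
              (M k (γ s).1 (γ s).2).real (Rel k m F η u (8 * (2 ^ j * B))) :=
          Finset.sum_le_sum hblock
      _ = C₆' * (a / ((2 ^ j * B : ℕ) : ℝ)) ^ (2 + ε) *
            ∑ u ∈ W.filter (fun u => ((2 ^ j * B : ℕ) : ℝ) ≤ x u ∧ x u < 2 * ((2 ^ j * B : ℕ) : ℝ)),
              (M k (γ s).1 (γ s).2).real (Rel k m F η u (8 * (2 ^ j * B))) := by
          rw [Finset.mul_sum]
      _ ≤ C₆' * (a / ((2 ^ j * B : ℕ) : ℝ)) ^ (2 + ε) *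
            (C₀' * (8 * ((2 ^ j * B : ℕ) : ℝ)) ^ 2 * (8 * ((2 ^ j * B : ℕ) : ℝ) * η) ^ b') :=
          mul_le_mul_of_nonneg_left hsum hpref
      _ ≤ (64 * (8 : ℝ) ^ b' * C₆' * C₀' * a ^ (2 + ε)) * ((2 ^ j * B : ℕ) : ℝ) ^ (-(ε / 2)) * η ^ b' :=
          sector_layer_algebra hX1 hη0 ha0 hC₆'0 hC₀'0 hb'ε
      _ = K₁ * ((2 ^ j * B : ℕ) : ℝ) ^ (-(ε / 2)) * η ^ b' := by rw [hK₁def]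
      _ ≤ K₁ * q ^ j * η ^ b' :=
          mul_le_mul_of_nonneg_right (mul_le_mul_of_nonneg_left hgeom hK₁0) (by positivity)
  -- (3) every block is small or lies in a layer `j < J`
  obtain ⟨T, hTdef⟩ : ∃ y : ℝ, y = (∑ u ∈ W, x u) + 1 := ⟨_, rfl⟩
  obtain ⟨J, hJ⟩ := pow_unbounded_of_one_lt T (one_lt_two : (1 : ℝ) < 2)
  have hcover : ∀ u ∈ W, f u ≤ (if x u < B then f u else 0) +
      ∑ j ∈ Finset.range J,
        (if ((2 ^ j * B : ℕ) : ℝ) ≤ x u ∧ x u < 2 * ((2 ^ j * B : ℕ) : ℝ) then f u else 0) := by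
    intro u hu
    have hterm0 : ∀ j, 0 ≤ (if ((2 ^ j * B : ℕ) : ℝ) ≤ x u ∧ x u < 2 * ((2 ^ j * B : ℕ) : ℝ)
        then f u else 0) := fun j => by
      split_ifs
      · exact hf0 u
      · exact le_rfl
    have hsum0 : 0 ≤ ∑ j ∈ Finset.range J,
        (if ((2 ^ j * B : ℕ) : ℝ) ≤ x u ∧ x u < 2 * ((2 ^ j * B : ℕ) : ℝ) then f u else 0) :=
      Finset.sum_nonneg fun j _ => hterm0 j
    by_cases hc : x u < B
    · rw [if_pos hc]
      linarith only [hsum0]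
    · rw [if_neg hc, zero_add]
      have hBx : (B : ℝ) ≤ x u := le_of_not_gt hc
      obtain ⟨y, hydef⟩ : ∃ z : ℝ, z = x u / B := ⟨_, rfl⟩
      have hxy : x u = y * B := by rw [hydef, div_mul_cancel₀ _ hBpos.ne']
      have hy1 : 1 ≤ y := by rw [hydef, le_div_iff₀ hBpos]; linarith only [hBx]
      obtain ⟨n, hn1, hn2⟩ := exists_nat_pow_near hy1 one_lt_two
      have hyT : y < T := by
        have h1 : x u ≤ ∑ v ∈ W, x v := Finset.single_le_sum (fun v _ => hx0 v) hu
        have h2 : y ≤ x u := by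
          rw [hydef, div_le_iff₀ hBpos]
          have := mul_le_mul_of_nonneg_left hB1r (hx0 u)
          linarith only [this]
        rw [hTdef]
        linarith only [h1, h2]
      have hnJ : n < J := by
        have : (2 : ℝ) ^ n < 2 ^ J := lt_of_le_of_lt hn1 (hyT.trans hJ)
        exact (pow_lt_pow_iff_right₀ one_lt_two).1 this
      have hlayer_n : ((2 ^ n * B : ℕ) : ℝ) ≤ x u ∧ x u < 2 * ((2 ^ n * B : ℕ) : ℝ) := by
        have hc2 : ((2 ^ n * B : ℕ) : ℝ) = 2 ^ n * B := by push_cast; ring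
        rw [hxy, hc2]
        constructor
        · exact mul_le_mul_of_nonneg_right hn1 hBpos.le
        · calc y * (B : ℝ) < 2 ^ (n + 1) * B := mul_lt_mul_of_pos_right hn2 hBpos
            _ = 2 * (2 ^ n * B) := by rw [pow_succ]; ring
      calc f u = (if ((2 ^ n * B : ℕ) : ℝ) ≤ x u ∧ x u < 2 * ((2 ^ n * B : ℕ) : ℝ) then f u else 0) := by
            rw [if_pos hlayer_n]
        _ ≤ ∑ j ∈ Finset.range J,
            (if ((2 ^ j * B : ℕ) : ℝ) ≤ x u ∧ x u < 2 * ((2 ^ j * B : ℕ) : ℝ) then f u else 0) :=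
          Finset.single_le_sum (f := fun j =>
              (if ((2 ^ j * B : ℕ) : ℝ) ≤ x u ∧ x u < 2 * ((2 ^ j * B : ℕ) : ℝ) then f u else 0))
            (fun j _ => hterm0 j) (Finset.mem_range.2 hnJ)
  -- (4) assemble
  have hgeomsum : ∑ j ∈ Finset.range J, q ^ j ≤ (1 - q)⁻¹ :=
    sum_le_hasSum (Finset.range J) (fun j _ => pow_nonneg hq0 j) (hasSum_geometric_of_lt_one hq0 hq1)
  have hηb : 0 ≤ η ^ b' := Real.rpow_nonneg hη0.le _
  calc ∑ u ∈ W, f u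
      ≤ ∑ u ∈ W, ((if x u < B then f u else 0) +
          ∑ j ∈ Finset.range J,
            (if ((2 ^ j * B : ℕ) : ℝ) ≤ x u ∧ x u < 2 * ((2 ^ j * B : ℕ) : ℝ) then f u else 0)) :=
        Finset.sum_le_sum hcover
    _ = ∑ u ∈ W.filter (fun u => x u < B), f u +
          ∑ j ∈ Finset.range J,
            ∑ u ∈ W.filter (fun u => ((2 ^ j * B : ℕ) : ℝ) ≤ x u ∧ x u < 2 * ((2 ^ j * B : ℕ) : ℝ)),
              f u := by
        rw [Finset.sum_add_distrib, Finset.sum_comm, Finset.sum_filter]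
        congr 1
        exact Finset.sum_congr rfl fun j _ => (Finset.sum_filter _ _).symm
    _ ≤ Ks * η ^ b' + ∑ j ∈ Finset.range J, K₁ * q ^ j * η ^ b' :=
        add_le_add hsmall (Finset.sum_le_sum fun j _ => hlayer j)
    _ = Ks * η ^ b' + K₁ * η ^ b' * ∑ j ∈ Finset.range J, q ^ j := by
        rw [Finset.mul_sum]
        congr 1
        exact Finset.sum_congr rfl fun j _ => by ring
    _ ≤ Ks * η ^ b' + K₁ * η ^ b' * (1 - q)⁻¹ :=
        add_le_add_right (mul_le_mul_of_nonneg_left hgeomsum (mul_nonneg hK₁0 hηb)) _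
    _ = (Ks + K₁ * (1 - q)⁻¹) * η ^ b' := by ring

end Summit.CriticalPhenomena.CardyFormulaZ2.Theorems.CardySelfRefinement.FarField

end
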